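import Summits.QuantumFields.YangMills.Theorems.UnitScaleTiltProp7TowerStraightTransport
import HarnessLib

/-!
# Route `UnitScaleTilt`, crux K1 «MinimiserStabilityRegPr» (stmt-QuantumFields-19200), route-R [RP] curved, the curved N6 row (R-C), transport geometry, Step B —
# HOLONOMIES OF THE BACKGROUND TOWER ALONG LEVEL-`k` WALKS ARE HOLONOMIES OF `U₀` ALONG THE `L^k`-DILATED FINE WALKS, UP TO `|w|·θ_k`:
# `‖Ū₀^{(k)}(walk y w) − U₀(walk (embIter k y) (w dilated by L^k))‖ ≤ |w|·θ_k`

Cell `ym3-torus`, width seat `ym-ust-20520-w2` (g3); sequel of ✓ p608723 `…TowerStraightTransport.norm_iter_sub_straightIter_le` (one bond: `‖Ū₀^{(k)}(c) − U₀(straight L^k)‖ ≤ θ_k`).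
Step B of the memo `RC-TRANSPORT-GEOMETRY-w2g3.md` (19200 evidence): every transport appearing in the pure `LINE`-iterate `S_k` (combs `stairWord σ (off r)` and straight
pieces at each level, holonomies of the tower fields `Ū₀^{(j)}`) is replaced by a `U₀`-holonomy of an explicit fine word (★p1's dilation `holAt_walk_of_straightIter`), at
cost `|w|·θ_j` per level-`j` walk `w` — with `θ_j = O(εL^{2(j−k)}/L)` for the geometric tower, `O(d·ε)` over a whole chain, k-uniform.  THEOREMS ONLY (0 `def`, 0 `sorry`);
`--supports stmt-QuantumFields-19200`, count-neutral.  YM₃ on T³ is a ladder rung (R3), not the Clay problem; nothing here claims the curved N6, S2, P, the crux or the gap.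

WHAT IS PROVED (ns `…Theorems.Prop7TowerWalkTransport`).
* §1 `norm_holAt_sub_holAt_le` — for two `SU(N)` fields and ANY step list `γ`: `‖A(γ) − B(γ)‖ ≤ Σ_{s∈γ}‖A(s.bond) − B(s.bond)‖` (both orientations; inverses of unitaries
  are isometric); `norm_holAt_sub_holAt_le_length_mul` (uniform per-bond bound `θ` ⇒ `≤ |γ|·θ`).
* §2 ★★ `norm_holAt_iter_walk_sub_dilated_le` — the title, under the hypotheses of ✓ p608723 (per-level loop sizes `a j ≤ 1/6`, `< δ_N`, dominating `θ`).
HONEST SCOPE.  Step B only; Steps A (closed form ∕ one-level expansion ⧗ `…LineOfTransportedFamily`), C (lattice Stokes) and the assembly remain.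

References: T. Bałaban, CMP 109 (1987) 249–301 [Balaban1987RG1] ((0.1), (0.4), (0.11) pp.252–253); CMP 98 (1985) 17–51 [Balaban1985Averaging] ((9) p.19).
-/

noncomputable section

open scoped BigOperators Matrix.Norms.L2Operator

namespace Summit.QuantumFields.YangMills.Theorems.Prop7TowerWalkTransport

open Literature.MathematicalPhysics.QuantumFieldTheory.Balaban1983to89
open Finset T4Continuum BlockAveraging AveragingRT ExpMeanLog BlockAveragingEMLProp2
open B15DeterminingSets (embIter)
open Summit.QuantumFields.YangMills.Theorems.Prop7HolRatioPerStep (norm_coe_eq_one)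
open Summit.QuantumFields.YangMills.Theorems.Prop7FlatHolonomy (holAt_walk_of_straightIter)
open BlockAveragingEMLLinearised (length_walk)
open Summit.QuantumFields.YangMills.Theorems.Prop7TowerStraightTransport (norm_iter_sub_straightIter_le)

variable {P : Params} {n : Type*} [Fintype n] [DecidableEq n] [Nonempty n] {j : ℕ}

/-! ## §1 Telescoping along an arbitrary step list -/

/-- **TELESCOPING**: `‖A(γ) − B(γ)‖ ≤ Σ_{s∈γ}‖A(s.bond) − B(s.bond)‖` for `SU(N)` fields and any step list (forward steps contribute `U_b`, backward ones `U_b⁻¹ = U_b*`,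
and `‖U* − V*‖ = ‖U − V‖`). [folklore] -/
theorem norm_holAt_sub_holAt_le (A B : GaugeField P j (Matrix.specialUnitaryGroup n ℂ)) :
    ∀ γ : List (LStep P j),
      ‖((holAt A γ : Matrix.specialUnitaryGroup n ℂ) : Matrix n n ℂ) - ((holAt B γ : Matrix.specialUnitaryGroup n ℂ) : Matrix n n ℂ)‖
        ≤ (γ.map fun s => ‖((A s.bond : Matrix.specialUnitaryGroup n ℂ) : Matrix n n ℂ) - ((B s.bond : Matrix.specialUnitaryGroup n ℂ) : Matrix n n ℂ)‖).sum
  | [] => by simp [holAt_nil]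
  | s :: γ => by
    rw [holAt_cons, holAt_cons, List.map_cons, List.sum_cons, Submonoid.coe_mul, Submonoid.coe_mul]
    have ih := norm_holAt_sub_holAt_le A B γ
    -- `‖ab − a′b′‖ ≤ ‖a − a′‖ + ‖b − b′‖` for `‖b‖, ‖a′‖ ≤ 1`
    have hprod : ∀ {a a' b b' : Matrix n n ℂ}, ‖b‖ ≤ 1 → ‖a'‖ ≤ 1 → ‖a * b - a' * b'‖ ≤ ‖a - a'‖ + ‖b - b'‖ := by
      intro a a' b b' hb ha'
      have e : a * b - a' * b' = (a - a') * b + a' * (b - b') := by noncomm_ring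
      rw [e]
      calc _ ≤ ‖a - a'‖ * ‖b‖ + ‖a'‖ * ‖b - b'‖ := (norm_add_le _ _).trans (add_le_add (norm_mul_le _ _) (norm_mul_le _ _))
        _ ≤ ‖a - a'‖ * 1 + 1 * ‖b - b'‖ := add_le_add (mul_le_mul_of_nonneg_left hb (norm_nonneg _)) (mul_le_mul_of_nonneg_right ha' (norm_nonneg _))
        _ = ‖a - a'‖ + ‖b - b'‖ := by ring
    -- the first factor: forward `U_b`, backward `U_b⁻¹` (an isometric image of `U_b`)
    have hfirst : ‖(((if s.fwd then A s.bond else (A s.bond)⁻¹ : Matrix.specialUnitaryGroup n ℂ)) : Matrix n n ℂ)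
          - (((if s.fwd then B s.bond else (B s.bond)⁻¹ : Matrix.specialUnitaryGroup n ℂ)) : Matrix n n ℂ)‖
        ≤ ‖((A s.bond : Matrix.specialUnitaryGroup n ℂ) : Matrix n n ℂ) - ((B s.bond : Matrix.specialUnitaryGroup n ℂ) : Matrix n n ℂ)‖ := by
      have hinv : ∀ g : Matrix.specialUnitaryGroup n ℂ, ((g⁻¹ : Matrix.specialUnitaryGroup n ℂ) : Matrix n n ℂ) = star (g : Matrix n n ℂ) := fun g => rfl
      cases s.fwd
      · simp only [Bool.false_eq_true, ↓reduceIte, hinv]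
        rw [← star_sub, norm_star]
      · simp
    calc _ ≤ ‖(((if s.fwd then A s.bond else (A s.bond)⁻¹ : Matrix.specialUnitaryGroup n ℂ)) : Matrix n n ℂ)
            - (((if s.fwd then B s.bond else (B s.bond)⁻¹ : Matrix.specialUnitaryGroup n ℂ)) : Matrix n n ℂ)‖
          + ‖((holAt A γ : Matrix.specialUnitaryGroup n ℂ) : Matrix n n ℂ) - ((holAt B γ : Matrix.specialUnitaryGroup n ℂ) : Matrix n n ℂ)‖ :=
          hprod (norm_coe_eq_one _).le (norm_coe_eq_one _).le
      _ ≤ _ := add_le_add hfirst ih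

/-- Uniform per-bond bound `θ` ⇒ `‖A(γ) − B(γ)‖ ≤ |γ|·θ`. [folklore] -/
theorem norm_holAt_sub_holAt_le_length_mul (A B : GaugeField P j (Matrix.specialUnitaryGroup n ℂ)) {θ : ℝ}
    (h : ∀ b : PBond P j, ‖((A b : Matrix.specialUnitaryGroup n ℂ) : Matrix n n ℂ) - ((B b : Matrix.specialUnitaryGroup n ℂ) : Matrix n n ℂ)‖ ≤ θ)
    (γ : List (LStep P j)) :
    ‖((holAt A γ : Matrix.specialUnitaryGroup n ℂ) : Matrix n n ℂ) - ((holAt B γ : Matrix.specialUnitaryGroup n ℂ) : Matrix n n ℂ)‖ ≤ γ.length * θ := by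
  refine (norm_holAt_sub_holAt_le A B γ).trans ?_
  have hle : ∀ x ∈ γ.map (fun s => ‖((A s.bond : Matrix.specialUnitaryGroup n ℂ) : Matrix n n ℂ) - ((B s.bond : Matrix.specialUnitaryGroup n ℂ) : Matrix n n ℂ)‖), x ≤ θ := by
    intro x hx
    obtain ⟨s, _, rfl⟩ := List.mem_map.mp hx
    exact h s.bond
  have := List.sum_le_card_nsmul _ θ hle
  rw [List.length_map, nsmul_eq_mul] at this
  exact this

/-! ## §2 ★★ Tower holonomies along level-`k` walks versus `U₀` along the dilated fine walks -/

/-- ★★ **`‖Ū₀^{(k)}(walk y w) − U₀(walk (embIter k y) (w dilated by L^k))‖ ≤ |w|·θ_k`** under the hypotheses of ✓ `norm_iter_sub_straightIter_le` (per-level loop sizes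
`a j ≤ 1/6`, `a j < δ_N` for `j < k`; `0 ≤ θ 0`, `2a_j + Lθ_j ≤ θ_{j+1}`): the dilated fine walk IS the walk of the straight-transporter field (★p1's `holAt_walk_of_straightIter`),
whose bond variables are `θ_k`-close to the tower's, and holonomies telescope (§1). [cite: Balaban1987RG1, (0.1) and (0.11) pp.252-253] -/
theorem norm_holAt_iter_walk_sub_dilated_le (U₀ : GaugeField P 0 (Matrix.specialUnitaryGroup n ℂ)) (a θ : ℕ → ℝ) (hθ0 : 0 ≤ θ 0)
    (hθ : ∀ j, 2 * a j + P.L * θ j ≤ θ (j + 1)) {k : ℕ}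
    (hα : ∀ j < k, ∀ (c : PBond P (j + 1)) (i : Idx P),
        dist1 (loopHol (Averaging.iter (fun i => blockAvg (P := P) (j := i) (expMeanLogSU (n := n))) j U₀) c i) ≤ a j)
    (h6 : ∀ j < k, a j ≤ 1 / 6) (hN : ∀ j < k, a j < deltaSU n) (y : Site P k) (w : List (Letter P.d)) :
    ‖((holAt (Averaging.iter (fun i => blockAvg (P := P) (j := i) (expMeanLogSU (n := n))) k U₀) (walk y w) : Matrix.specialUnitaryGroup n ℂ) : Matrix n n ℂ)
        - ((holAt U₀ (walk (embIter k y) (w.flatMap fun l => List.replicate (P.L ^ k) l)) : Matrix.specialUnitaryGroup n ℂ) : Matrix n n ℂ)‖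
      ≤ w.length * θ k := by
  rw [← holAt_walk_of_straightIter U₀ k y w, ← length_walk y w]
  exact norm_holAt_sub_holAt_le_length_mul _ _ (fun b => norm_iter_sub_straightIter_le U₀ a θ hθ0 hθ k hα h6 hN b) (walk y w)

end Summit.QuantumFields.YangMills.Theorems.Prop7TowerWalkTransport

end
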